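import Mathlib
import HarnessLib.Audit
import Summits.PneNP.PneNP.Theorems.PstarGateCaseTCube
import Summits.PneNP.PneNP.Theorems.PstarGateCaseTN3Tools
import Summits.PneNP.PneNP.Theorems.PstarGateBudget
import Summits.PneNP.PneNP.Theorems.PstarGateBudgetCross
import Summits.PneNP.PneNP.Theorems.PstarGateCaseTPair

/-!
# One GATED chord, OR-reader family: two private avoiding edges on the gated cycle are impossible (E2 node N3X; prover-1 g19)

FRONTIER range-avoidance ladder, rung F-N3 (`stmt-PneNP-19007`), cell `pnp-ideate` (`PstarGateNodesX.GateOrFamilyX`); restricted-model proof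
complexity — nothing here bears on `P` versus `NP`.

CASE T with affine `q_mv` and another chord; `π ≠ ν` the only `u`-avoiding edges of `D e` private within `D e`.  With no cross pair this is
`PstarGateCaseTCube.caseT_affine_cube_false`; a cross pair is carried by a tree edge of `T₂` (on `D e` it would be `π` and contain a variable
of `ν`; off `D e` it reads both, so no tree edge is private within `J₀ ∪ {g₀}` and `gate_budget` leaves `#F < 3`) or by a private-free gate of
`G₂` (then `gate_budget_cross` leaves `#F ≤ #N`, but `F ⊇ {π, ν}` plus the distinct `u`-edges of the other chords):

* `two_private_false` — **contradiction.**
-/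

set_option linter.dupNamespace false -- `Summit.PneNP.PneNP.…`: summit = sub-problem name (D-0017 single-conjunct layout)

open Finset Module Literature.Computability.Complexity
open scoped symmDiff
open Summit.PneNP.PneNP.Theorems.PstarTyped (Typed)
open Summit.PneNP.PneNP.Theorems.PstarSALevel (varSet bdry BoundaryExpanding SimpleOverlap)
open Summit.PneNP.PneNP.Theorems.PstarGapLinearised (andPair andPair_subset_varSet)
open Summit.PneNP.PneNP.Theorems.PstarChordEndgameTools (mem_andPair_iff not_two_shared)
open Summit.PneNP.PneNP.Theorems.PstarCentreFree (vars_mem_varSet)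
open Summit.PneNP.PneNP.Theorems.PstarXCore (xpair xverts mem_xpair)
open Summit.PneNP.PneNP.Theorems.PstarCubeIdeals (IsAffineFn)
open Summit.PneNP.PneNP.Theorems.PstarProductRank (qform polar)
open Summit.PneNP.PneNP.Theorems.PstarQuadRank (rad)
open Summit.PneNP.PneNP.Theorems.PstarPathRank (AndAdj polar_basis)
open Summit.PneNP.PneNP.Theorems.PstarPathRankFibre (avoid coordKer rank_restrict_ge)
open Summit.PneNP.PneNP.Theorems.PstarReadSumset (V2)
open Summit.PneNP.PneNP.Theorems.PstarChordSystem (ChordSystem)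
open Summit.PneNP.PneNP.Theorems.PstarChordBridgeTools (privs coef xpdeg)
open Summit.PneNP.PneNP.Theorems.PstarChordBridge (BridgeData sys)
open Summit.PneNP.PneNP.Theorems.PstarChordBridgeForcing (gam freeMon freePolar)
open Summit.PneNP.PneNP.Theorems.PstarChordBridgeBasis (qDir polarDir)
open Summit.PneNP.PneNP.Theorems.PstarChordBridgeFundamental (two_le_card_of_even eq_of_fundamental_eq)
open Summit.PneNP.PneNP.Theorems.PstarGateBridge (GateHyp)
open Summit.PneNP.PneNP.Theorems.PstarGateNodes (GateData)
open Summit.PneNP.PneNP.Theorems.PstarGateNodesX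
open Summit.PneNP.PneNP.Theorems.PstarGateCaseTCycle (matching_of_through)
open Summit.PneNP.PneNP.Theorems.PstarGateBudget (gate_budget)
open Summit.PneNP.PneNP.Theorems.PstarGateBudgetCross (gate_budget_cross)
open Summit.PneNP.PneNP.Theorems.PstarGateCaseTPair (xpair_subset_xverts_D)
open Summit.PneNP.PneNP.Theorems.PstarGateCaseTStructure (caseT_diff_single caseT_card_others_le_two)
open Summit.PneNP.PneNP.Theorems.PstarGateCaseTCube (caseT_affine_cube_false)
open Summit.PneNP.PneNP.Theorems.PstarGateCaseTN3Tools (cycle_budget private_mem_cycle)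

namespace Summit.PneNP.PneNP.Theorems.PstarGateOrFamilyCross

variable {n m : ℕ}

/-- **Two private avoiding edges on the gated cycle are impossible** (N3X).  See the module docstring. -/
theorem two_private_false (I : LocalMap 4 n m) (hI : I.IsPure xorAndPred) (hT : Typed I) (hS : SimpleOverlap I) {r₀ : ℕ}
    (hB : BoundaryExpanding r₀ I) {B : BridgeData n m} {e g₀ : Fin m} {u : Fin n} {κ₀ : ZMod 2} (hD : GateDataX I r₀ B e g₀ u κ₀)
    {mv : V2} (hmvT : mv = (0, 1) ∨ mv = (1, 1))
    (hP : ∀ e' ∈ B.N, e' ≠ e → ∀ a, ((sys I B).ρ e' a = 0 ∨ (sys I B).ρ e' a = mv) ∧ ((sys I B).ρ' e' a = 0 ∨ (sys I B).ρ' e' a = mv))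
    (hread : ∀ e' ∈ B.N, e' ≠ e → ∀ a, (sys I B).ρ e' a ≠ 0 ∨ (sys I B).ρ' e' a ≠ 0) (hN : (B.N.erase e).Nonempty)
    (hq : IsAffineFn (qDir I B mv)) {π ν : Fin m} (hπD : π ∈ B.D e) (hνD : ν ∈ B.D e) (hπν : π ≠ ν)
    (hπ2 : I.vars π 2 ≠ u) (hπ3 : I.vars π 3 ≠ u) (hν2 : I.vars ν 2 ≠ u) (hν3 : I.vars ν 3 ≠ u)
    (hpπ : ∀ j ∈ B.D e, j ≠ π → I.vars π 2 ∉ andPair I j ∧ I.vars π 3 ∉ andPair I j)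
    (hpν : ∀ j ∈ B.D e, j ≠ ν → I.vars ν 2 ∉ andPair I j ∧ I.vars ν 3 ∉ andPair I j)
    (honly : ∀ j ∈ B.D e, I.vars j 2 ≠ u → I.vars j 3 ≠ u →
      (∀ j' ∈ B.D e, j' ≠ j → I.vars j 2 ∉ andPair I j' ∧ I.vars j 3 ∉ andPair I j') → j = π ∨ j = ν) : False := by
  classical
  obtain ⟨hXc, hW, hr, hd₁, hd₂, -, -, -, hG, hg₀, hgv, -⟩ := id hD
  have he : e ∈ B.N := hG.1
  have hDeF : B.D e ⊆ B.J₀ \ B.N := hW.hD e he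
  have hDeJ : B.D e ⊆ B.J₀ := hDeF.trans sdiff_subset
  set F := B.J₀ \ B.N with hFdef
  have hN3 : B.N.card ≤ 3 := by
    have h := caseT_card_others_le_two I hI hT hS hB hD hmvT hP hread
    rw [card_erase_of_mem he] at h
    omega
  have hN2 : 2 ≤ B.N.card := by
    obtain ⟨e₁, he₁⟩ := hN
    have h := card_pos.2 ⟨e₁, he₁⟩
    rw [card_erase_of_mem he] at h
    omega
  obtain ⟨Pv, hPvF, hPvpriv, hbudget⟩ := gate_budget I hB hD
  change F.card + 1 ≤ _ at hbudget
  have hPvπν : ∀ j ∈ Pv, j = π ∨ j = ν := by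
    intro j hj
    obtain ⟨hjD, hj2, hj3, hjp⟩ := private_mem_cycle I hI hT hS hB hD hmvT hP hread hq (hPvF hj) (hPvpriv j hj)
    exact honly j hjD hj2 hj3 hjp
  by_cases hcross : ∀ s t : Fin 4, 2 ≤ s.val → 2 ≤ t.val →
      polarDir I B (1, 0) (Pi.single (I.vars π s) 1) (Pi.single (I.vars ν t) 1) = 0
  · exact caseT_affine_cube_false I hI hT hS hB hD hmvT hP hread hN hq hπD hνD hπν hπ2 hπ3 hν2 hν3 hpπ hpν hcross
  push Not at hcross
  obtain ⟨s, t, hs, ht, hst⟩ := hcross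
  -- a cross pair: an output of `T₂` or a private-free gate of `G₂` with AND pair `{π s, ν t}`
  have hadj : AndAdj I B.T₂ (I.vars π s) (I.vars ν t) ∨ AndAdj I (freeMon I B.N B.G₂) (I.vars π s) (I.vars ν t) := by
    by_contra hno
    rw [not_or] at hno
    apply hst
    unfold PstarChordBridgeBasis.polarDir PstarChordBridgeForcing.freePolar
    simp only [LinearMap.add_apply, LinearMap.smul_apply, polar_basis I hI hS, if_neg hno.1, if_neg hno.2]
    simp
  have hs23 : s = 2 ∨ s = 3 := by rcases s with ⟨s, h4⟩; simp only [Fin.ext_iff]; simp only at hs; omega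
  have ht23 : t = 2 ∨ t = 3 := by rcases t with ⟨t, h4⟩; simp only [Fin.ext_iff]; simp only at ht; omega
  have hπs_self : I.vars π s ∈ andPair I π := by
    rcases hs23 with rfl | rfl
    exacts [(mem_andPair_iff I π _).2 (Or.inl rfl), (mem_andPair_iff I π _).2 (Or.inr rfl)]
  have hνt_self : I.vars ν t ∈ andPair I ν := by
    rcases ht23 with rfl | rfl
    exacts [(mem_andPair_iff I ν _).2 (Or.inl rfl), (mem_andPair_iff I ν _).2 (Or.inr rfl)]
  have hπs_not : ∀ j' ∈ B.D e, j' ≠ π → I.vars π s ∉ andPair I j' := by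
    intro j' hj' hne; rcases hs23 with rfl | rfl; exacts [(hpπ j' hj' hne).1, (hpπ j' hj' hne).2]
  have hνt_not : ∀ j' ∈ B.D e, j' ≠ ν → I.vars ν t ∉ andPair I j' := by
    intro j' hj' hne; rcases ht23 with rfl | rfl; exacts [(hpν j' hj' hne).1, (hpν j' hj' hne).2]
  rcases hadj with ⟨o, hoT, hoeq⟩ | ⟨o, hofm, hoeq⟩
  · -- a tree edge `o ∈ T₂` with that pair: it reads `π s`, so `o = π`; but then `ν t ∈ andPair π`
    have hoF : o ∈ B.J₀ \ B.N := hW.hT₂ hoT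
    have hπso : I.vars π s ∈ andPair I o := by
      rcases hoeq with ⟨h2, -⟩ | ⟨-, h3⟩
      exacts [(mem_andPair_iff I o _).2 (Or.inl h2.symm), (mem_andPair_iff I o _).2 (Or.inr h3.symm)]
    have hνto : I.vars ν t ∈ andPair I o := by
      rcases hoeq with ⟨-, h3⟩ | ⟨h2, -⟩
      exacts [(mem_andPair_iff I o _).2 (Or.inr h3.symm), (mem_andPair_iff I o _).2 (Or.inl h2.symm)]
    -- `π ∈ Pv`?  we only know `π ∈ Pd`; use privacy within `D e` if `o ∈ D e`, else the global privacy of... no: use `Pv`.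
    -- Since `#Pv ≥ ?` is not known, argue with `Pd`: if `o ∈ D e` then `o = π` (privacy of `π` in `D e`) and `ν t ∈ andPair π` contradicts `ν`'s;
    -- if `o ∉ D e`, `o` is private within `J₀ ∪ {g₀}`?  Not needed: `o ∈ T₂ ⊆ F`; apply `private_mem_cycle` to... `o` need not be private.
    -- Instead: the budget.  `π, ν ∉ Pv` unless `o = π`/`o = ν`; but `Pv ⊆ Pd = {π, ν}`.
    by_cases hoD : o ∈ B.D e
    · by_cases hoπ : o = π
      · rw [hoπ] at hνto
        exact hνt_not π hπD hπν hνto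
      · exact hπs_not o hoD hoπ hπso
    · -- `o ∉ D e`: then `π ∉ Pv` and `ν ∉ Pv` (read by `o ∈ J₀`), so `Pv = ∅`
      have hoJ : o ∈ B.J₀ := (mem_sdiff.1 hoF).1
      have hoπ : o ≠ π := fun h => hoD (h ▸ hπD)
      have hoν : o ≠ ν := fun h => hoD (h ▸ hνD)
      have hπPv : π ∉ Pv := fun h => by
        have := hPvpriv π h o (mem_insert_of_mem hoJ) hoπ
        rcases hs23 with hs2 | hs3
        · exact this.1 (hs2 ▸ andPair_subset_varSet I o hπso)
        · exact this.2 (hs3 ▸ andPair_subset_varSet I o hπso)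
      have hνPv : ν ∉ Pv := fun h => by
        have := hPvpriv ν h o (mem_insert_of_mem hoJ) hoν
        rcases ht23 with ht2 | ht3
        · exact this.1 (ht2 ▸ andPair_subset_varSet I o hνto)
        · exact this.2 (ht3 ▸ andPair_subset_varSet I o hνto)
      have hPv0 : Pv = ∅ := by
        rw [eq_empty_iff_forall_notMem]
        intro j hj
        rcases hPvπν j hj with rfl | rfl
        exacts [hπPv hj, hνPv hj]
      rw [hPv0, card_empty, mul_zero, add_zero] at hbudget
      -- `F ⊇ {π, ν, o}`: three tree edges, but `#F + 1 ≤ #N ≤ 3` and `#J₀ ≥ 6`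
      have h3 : ({π, ν, o} : Finset (Fin m)) ⊆ F := insert_subset (hDeF hπD) (insert_subset (hDeF hνD) (singleton_subset_iff.2 hoF))
      have hc3 : ({π, ν, o} : Finset (Fin m)).card = 3 := by
        rw [card_insert_of_notMem, card_insert_of_notMem, card_singleton]
        · rw [mem_singleton]; exact Ne.symm hoν
        · rw [mem_insert, mem_singleton, not_or]; exact ⟨hπν, Ne.symm hoπ⟩
      have := card_le_card h3
      omega
  · -- a private-free gate `o ∈ G₂` with that pair: the cross budget
    have hoG₂ : o ∈ B.G₂ := (mem_filter.1 hofm).1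
    have hoJ : o ∉ B.J₀ := fun h => disjoint_left.1 hd₂ hoG₂ h
    have hu_g₀ : u ∈ andPair I g₀ := by
      rcases hgv with ⟨-, h3⟩ | ⟨h2, -⟩
      exacts [(mem_andPair_iff I g₀ u).2 (Or.inr h3.symm), (mem_andPair_iff I g₀ u).2 (Or.inl h2.symm)]
    have hog : o ≠ g₀ := by
      intro h
      rw [h] at hoeq
      have hπsu : I.vars π s ≠ u := by rcases hs23 with rfl | rfl; exacts [hπ2, hπ3]
      have hνtu : I.vars ν t ≠ u := by rcases ht23 with rfl | rfl; exacts [hν2, hν3]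
      rcases (mem_andPair_iff I g₀ u).1 hu_g₀ with hu | hu
      · rcases hoeq with ⟨h2, -⟩ | ⟨h2, -⟩
        exacts [hπsu (h2 ▸ hu).symm, hνtu (h2 ▸ hu).symm]
      · rcases hoeq with ⟨-, h3⟩ | ⟨-, h3⟩
        exacts [hνtu (h3 ▸ hu).symm, hπsu (h3 ▸ hu).symm]
    have hold2 : ∃ j ∈ B.J₀, I.vars o 2 ∈ varSet I j := by
      rcases hoeq with ⟨h2, -⟩ | ⟨h2, -⟩
      · exact ⟨π, hDeJ hπD, h2 ▸ vars_mem_varSet I π s⟩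
      · exact ⟨ν, hDeJ hνD, h2 ▸ vars_mem_varSet I ν t⟩
    have hold3 : ∃ j ∈ B.J₀, I.vars o 3 ∈ varSet I j := by
      rcases hoeq with ⟨-, h3⟩ | ⟨-, h3⟩
      · exact ⟨ν, hDeJ hνD, h3 ▸ vars_mem_varSet I ν t⟩
      · exact ⟨π, hDeJ hπD, h3 ▸ vars_mem_varSet I π s⟩
    obtain ⟨Pv', hPv'F, hPv'priv, hbudget'⟩ := gate_budget_cross I hB hD (mem_union_right _ hoG₂) hoJ hog hold2 hold3
    change F.card ≤ _ at hbudget'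
    have hoX : o ∈ insert o (insert g₀ B.J₀) := mem_insert_self _ _
    have hPv'0 : Pv' = ∅ := by
      rw [eq_empty_iff_forall_notMem]
      intro j hj
      obtain ⟨hjD, hj2, hj3, hjp⟩ := private_mem_cycle I hI hT hS hB hD hmvT hP hread hq (hPv'F hj)
        (fun j' hj' hne => hPv'priv j hj j' (mem_insert_of_mem hj') hne)
      have hjPd := honly j hjD hj2 hj3 hjp
      have hjJ : j ∈ B.J₀ := (mem_sdiff.1 (hPv'F hj)).1
      have hoj : o ≠ j := fun h => hoJ (h ▸ hjJ)
      have hpo := hPv'priv j hj o hoX hoj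
      rcases hjPd with rfl | rfl
      · rcases hoeq with ⟨h2, -⟩ | ⟨-, h3⟩
        · rcases hs23 with hs2 | hs3
          · exact hpo.1 (hs2 ▸ h2 ▸ vars_mem_varSet I o 2)
          · exact hpo.2 (hs3 ▸ h2 ▸ vars_mem_varSet I o 2)
        · rcases hs23 with hs2 | hs3
          · exact hpo.1 (hs2 ▸ h3 ▸ vars_mem_varSet I o 3)
          · exact hpo.2 (hs3 ▸ h3 ▸ vars_mem_varSet I o 3)
      · rcases hoeq with ⟨-, h3⟩ | ⟨h2, -⟩
        · rcases ht23 with ht2 | ht3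
          · exact hpo.1 (ht2 ▸ h3 ▸ vars_mem_varSet I o 3)
          · exact hpo.2 (ht3 ▸ h3 ▸ vars_mem_varSet I o 3)
        · rcases ht23 with ht2 | ht3
          · exact hpo.1 (ht2 ▸ h2 ▸ vars_mem_varSet I o 2)
          · exact hpo.2 (ht3 ▸ h2 ▸ vars_mem_varSet I o 2)
    rw [hPv'0, card_empty, mul_zero, add_zero] at hbudget'
    -- `F ⊇ {π, ν} ∪ {u-edges of the other chords}`: `#F > #N`
    obtain ⟨e₁, he₁⟩ := hN
    obtain ⟨m₁, hM₁, hm₁u, -⟩ := caseT_diff_single I hI hT hS hB hD hmvT hP hread (mem_of_mem_erase he₁) (ne_of_mem_erase he₁)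
    have hm₁M : m₁ ∈ B.D e ∆ B.D e₁ := by rw [hM₁]; exact mem_singleton_self _
    have hm₁F : m₁ ∈ F := by
      rcases Finset.mem_symmDiff.1 hm₁M with ⟨h, -⟩ | ⟨h, -⟩
      · exact hDeF h
      · exact hW.hD e₁ (mem_of_mem_erase he₁) h
    have hm₁π : m₁ ≠ π := by rintro rfl; rcases hm₁u with h | h; exacts [hπ2 h, hπ3 h]
    have hm₁ν : m₁ ≠ ν := by rintro rfl; rcases hm₁u with h | h; exacts [hν2 h, hν3 h]
    by_cases hN2' : B.N.card = 2
    · have h3 : ({π, ν, m₁} : Finset (Fin m)) ⊆ F := insert_subset (hDeF hπD) (insert_subset (hDeF hνD) (singleton_subset_iff.2 hm₁F))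
      have hc3 : ({π, ν, m₁} : Finset (Fin m)).card = 3 := by
        rw [card_insert_of_notMem, card_insert_of_notMem, card_singleton]
        · rw [mem_singleton]; exact Ne.symm hm₁ν
        · rw [mem_insert, mem_singleton, not_or]; exact ⟨hπν, Ne.symm hm₁π⟩
      have := card_le_card h3
      omega
    · -- three chords: two other chords with distinct `u`-edges
      have hN3' : B.N.card = 3 := by omega
      have hk2 : (B.N.erase e).card = 2 := by rw [card_erase_of_mem he]; omega
      obtain ⟨c₁, c₂, hc12, hNe⟩ := card_eq_two.1 hk2
      have hc₁ : c₁ ∈ B.N.erase e := by rw [hNe]; exact mem_insert_self _ _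
      have hc₂ : c₂ ∈ B.N.erase e := by rw [hNe]; exact mem_insert_of_mem (mem_singleton_self _)
      obtain ⟨n₁, hMn₁, hn₁u, -⟩ := caseT_diff_single I hI hT hS hB hD hmvT hP hread (mem_of_mem_erase hc₁) (ne_of_mem_erase hc₁)
      obtain ⟨n₂, hMn₂, hn₂u, -⟩ := caseT_diff_single I hI hT hS hB hD hmvT hP hread (mem_of_mem_erase hc₂) (ne_of_mem_erase hc₂)
      have hnF : ∀ {c k : Fin m}, c ∈ B.N.erase e → B.D e ∆ B.D c = {k} → k ∈ F := by
        intro c k hc hk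
        have hkM : k ∈ B.D e ∆ B.D c := by rw [hk]; exact mem_singleton_self _
        rcases Finset.mem_symmDiff.1 hkM with ⟨h, -⟩ | ⟨h, -⟩
        · exact hDeF h
        · exact hW.hD c (mem_of_mem_erase hc) h
      have hn12 : n₁ ≠ n₂ := by
        intro h12
        subst h12
        have hDD : B.D c₁ = B.D c₂ := by
          have h1 : B.D c₁ = B.D e ∆ {n₁} := by rw [← hMn₁, ← symmDiff_assoc, symmDiff_self, bot_symmDiff]
          have h2 : B.D c₂ = B.D e ∆ {n₁} := by rw [← hMn₂, ← symmDiff_assoc, symmDiff_self, bot_symmDiff]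
          rw [h1, h2]
        have hc₁N := mem_of_mem_erase hc₁
        have hc₂N := mem_of_mem_erase hc₂
        have hcD : c₁ ∉ B.D c₁ := fun h => (mem_sdiff.1 (hW.hD c₁ hc₁N h)).2 hc₁N
        have hc'D : c₂ ∉ B.D c₁ := fun h => (mem_sdiff.1 (hW.hD c₁ hc₁N h)).2 hc₂N
        have hev' : ∀ w, Even (xpdeg I (insert c₂ (B.D c₁)) w) := fun w => by rw [hDD]; exact hW.hDeven c₂ hc₂N w
        exact hc12 (eq_of_fundamental_eq I hI hS hcD hc'D (hW.hDeven c₁ hc₁N) hev')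
      have hthru_ne : ∀ {k : Fin m}, (I.vars k 2 = u ∨ I.vars k 3 = u) → k ≠ π ∧ k ≠ ν := by
        intro k hk
        constructor
        · rintro rfl; rcases hk with h | h; exacts [hπ2 h, hπ3 h]
        · rintro rfl; rcases hk with h | h; exacts [hν2 h, hν3 h]
      have h4 : ({π, ν, n₁, n₂} : Finset (Fin m)) ⊆ F :=
        insert_subset (hDeF hπD) (insert_subset (hDeF hνD) (insert_subset (hnF hc₁ hMn₁) (singleton_subset_iff.2 (hnF hc₂ hMn₂))))
      have hc4 : ({π, ν, n₁, n₂} : Finset (Fin m)).card = 4 := by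
        rw [card_insert_of_notMem, card_insert_of_notMem, card_insert_of_notMem, card_singleton]
        · rw [mem_singleton]; exact hn12
        · rw [mem_insert, mem_singleton, not_or]; exact ⟨(hthru_ne hn₁u).2.symm, (hthru_ne hn₂u).2.symm⟩
        · rw [mem_insert, mem_insert, mem_singleton, not_or, not_or]; exact ⟨hπν, (hthru_ne hn₁u).1.symm, (hthru_ne hn₂u).1.symm⟩
      have := card_le_card h4
      omega

end Summit.PneNP.PneNP.Theorems.PstarGateOrFamilyCross
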